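import Literature.MathematicalPhysics.QuantumFieldTheory.Balaban1983to89.B15Prop1RealChartFamilyVelocity
import Literature.MathematicalPhysics.QuantumFieldTheory.Balaban1983to89.B15Prop1RealChartFamilySupport
import Literature.MathematicalPhysics.QuantumFieldTheory.Balaban1983to89.B15Prop1RealChartFamilyGaugeTransport

/-!
# `Balaban1983to89.B15Prop1RealChartFamilyAtGauge` — [Balaban1985Variational] = «[15]», (3)–(4) p. 278, (15) p. 280, (172) p. 305, (181) p. 307, Prop. 9 (190) p. 309;
# [Balaban1989LargeFieldII] = «[LF-II]», p. 357 («we apply the construction of Sect. F [15] to the configuration U₀, and doing a proper gauge transformation we represent it …»),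
# (1.12) p. 359; [Balaban1988Convergent] = «[III]», (2.2) p. 255, (2.11)–(2.13) pp. 256–257:
# ★★★ THE (K′) PACKAGE AT ANY RESIDUAL GAUGE OF THE BASE MINIMISER — ONE knit-ready producer: family + velocity bound (K) + support letter, at `σ • U₀`

Honest framing: statement-level skeleton of published theorems with citation tags; proofs where landed; nothing here is a claim about the
Yang–Mills mass gap.  Cell `pub-ymgap`, HUMAN RULING D-0154 (R399 (3a) width seats), seat `pub-ymgap-dag-n12-w5` (g3; N12 = [B15], own lineage); count-neutral helper of K1⁸
(`stmt-QuantumFields-26907`); N12 NOT discharged; finite 𝕋⁴ at fixed ε; nothing continuum ∕ OS ∕ mass-gap ∕ Clay.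

WHY.  The localised endpoint `B15Prop1EndpointNearFlatLetters.…_ofNearFlatLetters_sub_loc_oneSided` (J-C v1.2) asks, per instance and base field, for ONE configuration carrying the
plaquette-local `A₀`-letter AND the real chart family with its letters.  The family is produced at the un-gauged base minimiser `U₀ = Ũ(0,0)` of the (J0′) chart
(`B15Prop1RealChartFamilyFromMinimiserChart` ∕ `…Explicit` ∕ `…Velocity`), the `A₀`-letter at a residual block-axial representative `σ • U₀` (dag-n12-w6 lineage).  This module
composes the lineage ONCE, in the shape the knit instantiates `hNF`'s family conjuncts with: from (J0′)'s clauses at one base field it yields a base minimiser `U₀`, and THEN, for EVERY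
residual `σ` (root letter `hu`), a family `X_f^σ` at `σ • U₀` with `X_f^σ 0 = 0`, `C²` at `0`, minimality near `0`, the velocity bounds (K) `‖↑(DX_f^σ(0)X(b))‖ ≤ 8𝓐₀∕R·‖X‖`,
`‖DX_f^σ(0)X(b)‖ ≤ 12𝓐₀∕R·‖X‖`, and the support letter (`X_f^σ Y (b) = 0` and `DX_f^σ(0)X(b) = 0` for `b₋ ∉ Ω₁(Z)`) — by `exists_realChartFamily_hval_velocity_atRecord` (p613674),
`realChartFamily_gaugeAct_atRecord` (p618388) and `support_realChartFamily_atRecord` (p616516).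

CONTENTS (theorems only; no `def`, no `instance`, no `sorry`).
* ★★★ `exists_realChartFamily_atGauge_atRecord` — the composed producer at the endpoint's objects (`Node00.avOfRecord F 2 Kt`, `Node00.regMSCoPOfRecord F 2 ν Kt k (maxDomT ν.M₁ Z)`,
  `Bj ν.M₁ Z k`, `GaugeSlice (pts k Λ) T E3`, base field `ext Ṽ_k`, `0 < k ≤ m + K`, the endpoint's `hfar` clause).
HONEST SCOPE: composition by name of this lineage's landed theorems; (J0′)'s chart and `σ` are HYPOTHESES; no near-flatness is proved; nothing of Bałaban's estimates asserted;
N12 NOT discharged; K1⁸ NOT closed.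
-/

noncomputable section

open Set Metric Filter
open scoped Topology Matrix.Norms.L2Operator

namespace Literature.MathematicalPhysics.QuantumFieldTheory.Balaban1983to89.B15Prop1RealChartFamilyAtGauge

open B15Prop1SliceCoordinates (GaugeSlice ιA)
open B15Prop1ChartCalculusSU2 (E3)
open B15Prop1ChartSU2 (su2Chart)
open T4CubeChartGnomonic (SU2)
open T4Continuum B15DeterminingSets GaugeField
open T4AdjointCovarianceUnitary (lieSU specialUnitaryAd)
open Node00 (expChart)
open B14.Eq213DetSet B14.Eq216Concrete B14.Eq22Determines
open B16Sect1Backgrounds (expMul toMS)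
open B15Prop1AnalyticExtClause (cplxVec)
open Literature.MathematicalPhysics.QuantumLattice (quatMatrix)
open T4HaarSU2ExpChart (imQuat)
open B15Prop1RealChartFamilyVelocity (exists_realChartFamily_hval_velocity_atRecord)
open B15Prop1RealChartFamilySupport (support_realChartFamily_atRecord)
open B15Prop1RealChartFamilyGaugeTransport (realChartFamily_gaugeAct_atRecord)
open Literature.MathematicalPhysics.QuantumFieldTheory.BalabanImbrieJaffe1984to88.BIJ85Eq453GaugeField (qsstarGIter0)

variable {F : T4Family}

/-- ★★★ **THE (K′) PACKAGE AT ANY RESIDUAL GAUGE OF THE BASE MINIMISER, AT THE ENDPOINT'S OBJECTS.**  From (J0′)'s clauses at one base field `Ṽ_k` (holomorphic minimiser chart `Ũ` on the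
ball of radius `R` with the bound `𝓐₀`, real points = (2.12) minimisers) for the Prop-1 instance's averaging ∕ class ∕ determining set ∕ slice, with `0 < k ≤ m + K` and the endpoint's
`hfar` clause: there is a base minimiser `U₀` (for the datum `M˙(Q_k^{s*}(ext Ṽ_k))`) such that FOR EVERY residual gauge transformation `σ` of the constraints (`hu`: trivial on the block
towers under the endpoints of the bonds of `𝐁_k(Z)`) there is a family `X_f^σ` at `σ • U₀` with: `X_f^σ 0 = 0`; `ContDiffAt ℝ 2 X_f^σ 0`; `expChart (σ • U₀) (X_f^σ Y)` a (2.12) minimiser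
of `M˙(Q_k^{s*}(exp(i·ιA Y)·ext Ṽ_k))` for `Y` near `0`; the velocity bounds (K) `‖↑(DX_f^σ(0)X(b))‖ ≤ 8𝓐₀∕R·‖X‖` and `‖DX_f^σ(0)X(b)‖ ≤ 12𝓐₀∕R·‖X‖`; and the support letter
(`X_f^σ Y (b) = 0` near `Y = 0` and `DX_f^σ(0)X(b) = 0` whenever `b₋ ∉ Ω₁(Z) = maxDomT ν.M₁ Z 1`).  Composition of p613674 (family + (K) at `U₀`), p618388 (transport to `σ • U₀`,
sizes preserved) and p616516 (support at `σ • U₀`).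
[cite: Balaban1985Variational, (3)–(4) p.278, (15) p.280, (172) p.305, (181) p.307, Prop. 9 (190) p.309; Balaban1989LargeFieldII, p.357, (1.12) p.359; Balaban1989LargeFieldI, (1.74) p.192, Prop. 1 p.194 (last clause); Balaban1988Convergent, (2.2) p.255, (2.11)–(2.13) pp.256–257] -/
theorem exists_realChartFamily_atGauge_atRecord (ν : Node00.Stage7Numerics) (Kt : ℕ) {k : ℕ} (hk0 : 0 < k) (hk : k ≤ (F.P Kt).m + (F.P Kt).K)
    (Z Λ : Set (Site (F.P Kt) 0)) (T : Finset (PBond (F.P Kt) k))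
    (φ : EuclideanSpace ℝ (Fin 3) →ₗ[ℝ] lieSU (Fin 2)) (hφ : ∀ v, ((φ v : lieSU (Fin 2)) : Matrix (Fin 2) (Fin 2) ℂ) = quatMatrix (imQuat v))
    (ext : GaugeField (F.P Kt) k SU2 → GaugeField (F.P Kt) k SU2) (Vk : GaugeField (F.P Kt) k SU2) {R : ℝ} (hR : 0 < R)
    (Ũ : VecField (F.P Kt) k (EuclideanSpace ℂ (Fin 3)) × VecField (F.P Kt) k (EuclideanSpace ℂ (Fin 3)) → PBond (F.P Kt) 0 → Matrix (Fin 2) (Fin 2) ℂ)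
    (hdiff : ∀ b a c, DifferentiableOn ℂ (fun z => Ũ z b a c) (ball 0 R))
    {𝓐₀ : ℝ} (h𝓐 : ∀ z ∈ ball (0 : VecField (F.P Kt) k (EuclideanSpace ℂ (Fin 3)) × VecField (F.P Kt) k (EuclideanSpace ℂ (Fin 3))) R, ∀ b a c, ‖Ũ z b a c‖ ≤ 𝓐₀)
    (hreal : ∀ p B' : VecField (F.P Kt) k E3, ‖p‖ < R → ‖B'‖ < R → ∃ U' : GaugeField (F.P Kt) 0 SU2,
      (∀ b, Ũ (cplxVec p, cplxVec B') b = ((U' b : SU2) : Matrix (Fin 2) (Fin 2) ℂ)) ∧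
        IsMinimizer (Node00.avOfRecord F 2 Kt) (Node00.regMSCoPOfRecord F 2 ν Kt k (maxDomT ν.M₁ Z)) (Bj ν.M₁ Z k)
          (avgFamily (Node00.avOfRecord F 2 Kt) (qsstarGIter0 k (expMul su2Chart B' (ext (expMul su2Chart p Vk))))) U')
    (hfar : ∀ b : PBond (F.P Kt) 0, b.src ∉ maxDomT ν.M₁ Z 1 → (⟨blockIter k b.src, b.dir⟩ : PBond (F.P Kt) k) ∉ bondsOf (pts k Λ)) :
    ∃ U₀ : GaugeField (F.P Kt) 0 SU2,
      IsMinimizer (Node00.avOfRecord F 2 Kt) (Node00.regMSCoPOfRecord F 2 ν Kt k (maxDomT ν.M₁ Z)) (Bj ν.M₁ Z k)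
        (avgFamily (Node00.avOfRecord F 2 Kt) (qsstarGIter0 k (ext Vk))) U₀ ∧
      ∀ σ : GaugeTransf (F.P Kt) 0 SU2, (∀ j, j ≤ k → ∀ b ∈ bondsOf (Bj ν.M₁ Z k j), toMS σ j b.src = 1 ∧ toMS σ j b.tgt = 1) →
        ∃ Xf : GaugeSlice (pts k Λ) T E3 → PBond (F.P Kt) 0 → lieSU (Fin 2),
          Xf 0 = 0 ∧ ContDiffAt ℝ 2 Xf 0 ∧
          (∀ᶠ Y in 𝓝 (0 : GaugeSlice (pts k Λ) T E3),
            IsMinimizer (Node00.avOfRecord F 2 Kt) (Node00.regMSCoPOfRecord F 2 ν Kt k (maxDomT ν.M₁ Z)) (Bj ν.M₁ Z k)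
              (avgFamily (Node00.avOfRecord F 2 Kt) (qsstarGIter0 k (expMul su2Chart (ιA (pts k Λ) T Y) (ext Vk)))) (expChart (gaugeAct σ U₀) (Xf Y))) ∧
          (∀ (X : GaugeSlice (pts k Λ) T E3) (b : PBond (F.P Kt) 0),
            ‖((fderiv ℝ Xf 0 X b : lieSU (Fin 2)) : Matrix (Fin 2) (Fin 2) ℂ)‖ ≤ 8 * 𝓐₀ / R * ‖X‖ ∧ ‖fderiv ℝ Xf 0 X b‖ ≤ 12 * 𝓐₀ / R * ‖X‖) ∧
          (∀ᶠ Y in 𝓝 (0 : GaugeSlice (pts k Λ) T E3), ∀ b : PBond (F.P Kt) 0, b.src ∉ maxDomT ν.M₁ Z 1 → Xf Y b = 0) ∧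
          ∀ (X : GaugeSlice (pts k Λ) T E3) (b : PBond (F.P Kt) 0), b.src ∉ maxDomT ν.M₁ Z 1 → fderiv ℝ Xf 0 X b = 0 := by
  obtain ⟨U₀, Xf, hX₀, hXc, -, -, -, hmin0, hmin, -, hK⟩ :=
    exists_realChartFamily_hval_velocity_atRecord ν Kt k (maxDomT ν.M₁ Z) ν.M₁ Z (pts k Λ) T φ hφ ext Vk hR Ũ hdiff h𝓐 hreal
  refine ⟨U₀, hmin0, fun σ hu => ?_⟩
  obtain ⟨h0, hc, hm, hvel⟩ := realChartFamily_gaugeAct_atRecord ν Kt hk Z Λ T ext Vk σ hu U₀ Xf hX₀ hXc hmin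
  have h0' : (fun Y b => specialUnitaryAd (σ b.tgt) (Xf Y b)) 0 = 0 := h0
  obtain ⟨hsuppY, hsuppD⟩ := support_realChartFamily_atRecord ν Kt hk0 hk Z Λ T ext Vk hfar (gaugeAct σ U₀)
    (fun Y b => specialUnitaryAd (σ b.tgt) (Xf Y b)) h0' hc.continuousAt hm
  refine ⟨fun Y b => specialUnitaryAd (σ b.tgt) (Xf Y b), h0', hc, hm, fun X b => ?_, hsuppY, hsuppD⟩
  obtain ⟨-, hHS, hop, -⟩ := hvel X b
  exact ⟨hop ▸ (hK X b).1, hHS ▸ (hK X b).2⟩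

end Literature.MathematicalPhysics.QuantumFieldTheory.Balaban1983to89.B15Prop1RealChartFamilyAtGauge

end
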